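/-
Copyright (c) 2026 the pub-hodgecm-mathlib formalisation cell (harness21).  Prover seat hodgecm-mathlib-K2E1-p13 (g6), Track B ∕ K2-LIT, h413 = `stmt-HodgeConjecture-24833`,
R90-TF section S8 «ContSpec-n½», S8 dealer R90-CS-plan (g3) S8-R233 (2) «`K2E1ChiAmplitudeOfTranslateU3` — NAME `Ag g z`, prove `hAg hM`, `hAg1` definitional» (J-S8-U (b), K2E1-p11's
ℓ-CT census (4)); this seat's census 2026-09-05T02:47:40Z (R90 bus): THE COORDINATE ROAD — the translate amplitude is AFFINE IN THE (b′) BASIS, so the amplitude rows of ★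
`ctLedger_of_amplitudeRows(_codiscrete)` (K2E1-p11, ★ `K2E1ChiConstantTermLedgerOfRecordCMThree`) follow from the scattering-COORDINATE Euler factorisation (K2E2-p12, S8-R234) and
★ `hsrc` at the base point, with no per-translate unfolding.
-/
import Mathlib.Analysis.Calculus.Deriv.Add
import Mathlib.Analysis.Calculus.Deriv.Mul
import Mathlib.Analysis.Complex.Basic
import HarnessLib

/-!
# K2·E1 ∕ R90·S8 — `K2E1ChiAmplitudeOfTranslateU3`: THE AMPLITUDE OF A TRANSLATE, NAMED ON THE COORDINATE ROAD — `Ag g z := A z + Σ_j a_j(z)·(b_j(g) − b_j(g₁))`, its rows `hAg hAg1 hM`, and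
# the unfolding row `hψ2` for EVERY translate from the coordinate factorisation `Q_j = a_j·cS`

Cell `pub/hodgecm-mathlib`, crux h413 = `stmt-HodgeConjecture-24833`, route of record `HCCMUnconditional`; R90-TF section S8 «ContSpec-n½», road R2-χ₃ ((V) OF RECORD row (ii): the ℓ-CT
letters `ψ φt hE3 hfac hφt hg₀ hφtbd` collapse, by ★ `ctLedger_of_amplitudeRows_codiscrete` (K2E1-p11), to the AMPLITUDE ROWS `Ag hAg hAg1 hM hψ2`).  ONE DEFINITION (`amplitudeOfTranslate`,
the literal lambda the consumer's binder `Ag` is instantiated with) + THEOREMS; no `instance`, no notation, no named-fact hypothesis, no `sorry`; default heartbeats; GENERIC in the group `G`,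
the index type `ι` of the basis, and the scalar data — Mathlib-only imports.  Lane `--supports stmt-HodgeConjecture-24833 --as helper` (count-neutral).  CLOSES NO SOCKET: it names the
amplitude family and proves three of its four rows outright and the fourth (`hψ2`) from three displayed equalities on `{2 < Re}`.

THE MATHEMATICS ([MoeglinWaldspurger1995] II.1.7, IV.1.9–IV.1.11; [Langlands1976] §6, Appendix).  Let `ψ(z, g)` be the normalised second constant-term coefficient of the Eisenstein family of the
witness (`(E_z)_B(g) = φ(g)H(g)^z + ψ(z,g)H(g)^{2−z}`).  The intertwined section `M(z)φ_z` lies in the induced space of the REFLECTED parameter, which at the fixed level and `K_∞`-type is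
FINITE-dimensional with a `z`-INDEPENDENT basis `b_j` of bounded continuous sections (the (b′) basis `bV` of (V) OF RECORD, bound `Mb`); hence on `{2 < Re z}`
  `ψ(z, g) = Σ_j Q_j(z)·b_j(g)`  for EVERY `g ∈ G(𝔸)`                                                        (★ `midWitnessExports_spec`, clause 2: the scattering COORDINATES `Q_j`),
so the `g`-dependence of `ψ` is spanned by finitely many fixed functions.  If the coordinates factor through the good-place Euler quotient, `Q_j = a_j·cS` on `{2 < Re}` with `a_j`
holomorphic on `{1 < Re}` (K2E2-p12's coordinate factorisation, S8-R234 — the same bad-place local integrals as ★ `hsrc`), and `ψ(z, g₁) = A(z)·cS(z)` at the base point (★ `hsrc`, R90-CS-p03),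
then the family
  **`Ag g z := A z + Σ_j a_j(z)·(b_j(g) − b_j(g₁))`**
satisfies ALL FOUR amplitude rows: `hAg` (holomorphic on `{1<Re}`: `A` is, ★ p864534, and the `a_j` are), `hAg1 : Ag g₁ = A` EXACTLY (the sum vanishes at `g₁`), `hM : ‖Ag g (3∕2)‖ ≤
‖A(3∕2)‖ + Σ_j ‖a_j(3∕2)‖·2Mb` UNIFORMLY in `g`, and `hψ2`: `Ag g z·cS z = ψ(z,g₁) + Σ_j Q_j(z)(b_j(g) − b_j(g₁)) = ψ(z,g₁) + (ψ(z,g) − ψ(z,g₁)) = ψ(z,g)`.  No translated local data, no Iwasawa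
reduction of the translate and no local lemma at the places where `g_v ∉ K_v` are needed for the (V) road (they remain the road for an all-translates unfolding `hUNF` of (R)′, if wanted).
* §1 `amplitudeOfTranslate A a b g₁` (the def) + `amplitudeOfTranslate_apply`; rows **`differentiableOn_amplitudeOfTranslate`** (`hAg`, on any set where `A` and the `a_j` are
  differentiable), **`amplitudeOfTranslate_base`** (`hAg1`), **`norm_amplitudeOfTranslate_le`** (`hM` at any point `z₀`, from `‖b_j‖ ≤ Mb`).
* §2 **`hψ2_of_coordFactorisation`** — `ψ z g = Ag g z · cS z` on `{2 < Re}` from (`hexp`) the coordinate expansion, (`hQ`) `Q_j = a_j·cS`, (`hq`) `ψ z g₁ = A z·cS z`; `'`-variant with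
  `Q_j = cS·a_j`; `apply_eq_sum_mul_of_sum_smul_eq` reads ★ clause 2's function identity `Σ_j Q_j • b_j = F` pointwise.
* §3 **`amplitudeRows_of_coordFactorisation`** — the four binders `(hAg) (hAg1) (hM) (hψ2)` of ★ `ctLedger_of_amplitudeRows_codiscrete` in ONE conclusion, `Ag := amplitudeOfTranslate A a b g₁`,
  `M := ‖A (3∕2)‖ + Σ_j ‖a_j (3∕2)‖·(Mb + Mb)`.
HONEST LABEL: HC_CM is proved only modulo the 7 printed citations (2 remaining named inputs: hLiu418 = `stmt-HodgeConjecture-24832`, h413 = `stmt-HodgeConjecture-24833`) until rung 0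
closes; REL ≠ ★ ≠ BUILT; this file asserts no named fact and closes no socket — after it the amplitude rows are ★ modulo {the coordinate factorisation `a_j` (K2E2-p12, itself modulo the
`hΩ` core + tokens), ★ `hsrc`'s letters, the identification of the ledger's `ψ` with clause 2's unfolded form (★ (U1))}; count-neutral.

## References
* [MoeglinWaldspurger1995] C. Mœglin, J.-L. Waldspurger, *Spectral Decomposition and Eisenstein Series* (1995): II.1.7, IV.1.9–IV.1.11.
* [Langlands1976] R. P. Langlands, *On the Functional Equations Satisfied by Eisenstein Series*, LNM 544 (1976): §6, Appendix.
* [Rogawski1990] J. D. Rogawski, *Automorphic Representations of Unitary Groups in Three Variables*, Ann. of Math. Stud. 123 (1990): §13.9 p. 229.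
-/

set_option autoImplicit false
set_option linter.dupNamespace false -- the mandated namespace repeats `HodgeConjecture.HodgeConjecture`

noncomputable section

open scoped BigOperators

namespace Summit.HodgeConjecture.HodgeConjecture.Cruxes.H413.K2E1ChiAmplitudeOfTranslateU3

variable {G : Type*} {ι : Type*} [Fintype ι]

/-! ## §1 The amplitude of a translate on the coordinate road, and its three elementary rows -/

/-- **THE AMPLITUDE OF THE TRANSLATE `g` — `amplitudeOfTranslate A a b g₁ g z := A z + Σ_j a_j(z)·(b_j(g) − b_j(g₁))`**: `A` the amplitude of record at the base point `g₁` (★ F5∕(V) `A`), `a_j` the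
Euler-free amplitudes of the scattering coordinates (`Q_j = a_j·cS`), `b_j` the fixed basis of the reflected section space ((V)'s `bV`).  The literal `Ag` of ★
`ctLedger_of_amplitudeRows_codiscrete`. [cite: MoeglinWaldspurger1995, IV.1.9–IV.1.11] [cite: Langlands1976, §6] -/
def amplitudeOfTranslate (A : ℂ → ℂ) (a : ι → ℂ → ℂ) (b : ι → G → ℂ) (g₁ : G) : G → ℂ → ℂ :=
  fun g z => A z + ∑ j, a j z * (b j g - b j g₁)

/-- Read-back (`rfl`). [cite: MoeglinWaldspurger1995, IV.1.11] -/
theorem amplitudeOfTranslate_apply (A : ℂ → ℂ) (a : ι → ℂ → ℂ) (b : ι → G → ℂ) (g₁ g : G) (z : ℂ) :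
    amplitudeOfTranslate A a b g₁ g z = A z + ∑ j, a j z * (b j g - b j g₁) := rfl

/-- `Ag g` as a function of `z` (`rfl`). [cite: MoeglinWaldspurger1995, IV.1.11] -/
theorem amplitudeOfTranslate_eq (A : ℂ → ℂ) (a : ι → ℂ → ℂ) (b : ι → G → ℂ) (g₁ g : G) :
    amplitudeOfTranslate A a b g₁ g = fun z => A z + ∑ j, a j z * (b j g - b j g₁) := rfl

/-- **ROW `hAg1` — `Ag g₁ = A` EXACTLY** (every difference `b_j(g₁) − b_j(g₁)` vanishes). [cite: MoeglinWaldspurger1995, IV.1.11] -/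
theorem amplitudeOfTranslate_base (A : ℂ → ℂ) (a : ι → ℂ → ℂ) (b : ι → G → ℂ) (g₁ : G) : amplitudeOfTranslate A a b g₁ g₁ = A := by
  funext z
  simp only [amplitudeOfTranslate_apply, sub_self, mul_zero, Finset.sum_const_zero, add_zero]

/-- **ROW `hAg` — `Ag g` is differentiable wherever `A` and the `a_j` are** (in the application: holomorphic on `{1 < Re}`, ★ p864534 `hA` and K2E2-p12's `a_j`). [cite: MoeglinWaldspurger1995, IV.1.11] -/
theorem differentiableOn_amplitudeOfTranslate {A : ℂ → ℂ} {s : Set ℂ} (hA : DifferentiableOn ℂ A s) {a : ι → ℂ → ℂ} (ha : ∀ j, DifferentiableOn ℂ (a j) s)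
    (b : ι → G → ℂ) (g₁ : G) : ∀ g, DifferentiableOn ℂ (amplitudeOfTranslate A a b g₁ g) s := fun g => by
  rw [amplitudeOfTranslate_eq]
  exact DifferentiableOn.add hA (DifferentiableOn.fun_sum (u := Finset.univ) fun j _ => DifferentiableOn.mul_const (ha j) _)

/-- **ROW `hM` — THE UNIFORM BOUND**: if `‖b_j(x)‖ ≤ Mb` for all `j, x`, then at every point `z₀`, `‖Ag g z₀‖ ≤ ‖A z₀‖ + Σ_j ‖a_j z₀‖·(Mb + Mb)` for EVERY `g` ((V)'s `hbM`).
[cite: MoeglinWaldspurger1995, IV.1.11] [cite: Langlands1976, Appendix] -/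
theorem norm_amplitudeOfTranslate_le (A : ℂ → ℂ) (a : ι → ℂ → ℂ) {b : ι → G → ℂ} {Mb : ℝ} (hbM : ∀ j x, ‖b j x‖ ≤ Mb) (g₁ : G) (z₀ : ℂ) :
    ∀ g, ‖amplitudeOfTranslate A a b g₁ g z₀‖ ≤ ‖A z₀‖ + ∑ j, ‖a j z₀‖ * (Mb + Mb) := fun g => by
  rw [amplitudeOfTranslate_apply]
  refine (norm_add_le _ _).trans (add_le_add le_rfl ((norm_sum_le _ _).trans (Finset.sum_le_sum fun j _ => ?_)))
  rw [norm_mul]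
  exact mul_le_mul_of_nonneg_left ((norm_sub_le _ _).trans (add_le_add (hbM j g) (hbM j g₁))) (norm_nonneg _)

/-- The bound at `3∕2` — the literal `hM` of ★ `ctLedger_of_amplitudeRows_codiscrete`. [cite: MoeglinWaldspurger1995, IV.1.11] -/
theorem norm_amplitudeOfTranslate_three_halves_le (A : ℂ → ℂ) (a : ι → ℂ → ℂ) {b : ι → G → ℂ} {Mb : ℝ} (hbM : ∀ j x, ‖b j x‖ ≤ Mb) (g₁ : G) :
    ∀ g, ‖amplitudeOfTranslate A a b g₁ g (3 / 2)‖ ≤ ‖A (3 / 2)‖ + ∑ j, ‖a j (3 / 2)‖ * (Mb + Mb) :=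
  norm_amplitudeOfTranslate_le A a hbM g₁ (3 / 2)

/-! ## §2 ROW `hψ2` for EVERY translate from three equalities on `{2 < Re}` -/

/-- Reading a function identity `Σ_j Q_j • b_j = F` (★ `midWitnessExports_spec` clause 2's shape) pointwise: `F g = Σ_j Q_j·b_j(g)`. [cite: MoeglinWaldspurger1995, IV.1.9] -/
theorem apply_eq_sum_mul_of_sum_smul_eq {Q : ι → ℂ} {b : ι → G → ℂ} {F : G → ℂ} (h : ∑ j, Q j • b j = F) (g : G) : F g = ∑ j, Q j * b j g := by
  rw [← h, Finset.sum_apply]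
  exact Finset.sum_congr rfl fun j _ => by rw [Pi.smul_apply, smul_eq_mul]

/-- The same against a scalar multiple `Σ_j Q_j • b_j = c • F₀` (clause 2 carries the factor `(ν𝓕)⁻¹`): `c·F₀ g = Σ_j Q_j·b_j(g)`. [cite: MoeglinWaldspurger1995, IV.1.9] -/
theorem smul_apply_eq_sum_mul_of_sum_smul_eq {Q : ι → ℂ} {b : ι → G → ℂ} {c : ℂ} {F₀ : G → ℂ} (h : ∑ j, Q j • b j = c • F₀) (g : G) : c * F₀ g = ∑ j, Q j * b j g := by
  have e := apply_eq_sum_mul_of_sum_smul_eq h g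
  rwa [Pi.smul_apply, smul_eq_mul] at e

/-- **ROW `hψ2` FOR EVERY TRANSLATE — `ψ z g = Ag g z · cS z` on `{2 < Re}`** from: (`hexp`) the coordinate expansion `ψ z g = Σ_j Q_j(z)·b_j(g)` at every `g` (★ clause 2), (`hQ`) the
coordinate factorisation `Q_j z = a_j z · cS z` (K2E2-p12), (`hq`) the base point `ψ z g₁ = A z · cS z` (★ `hsrc`, `q z := ψ z g₁`).  Three lines of algebra:
`Ag g z·cS z = ψ z g₁ + Σ_j Q_j z·(b_j g − b_j g₁) = ψ z g₁ + (ψ z g − ψ z g₁)`. [cite: MoeglinWaldspurger1995, IV.1.9–IV.1.11] [cite: Langlands1976, §6] -/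
theorem hψ2_of_coordFactorisation (ψ : ℂ → G → ℂ) (Q a : ι → ℂ → ℂ) (b : ι → G → ℂ) (A cS : ℂ → ℂ) (g₁ : G)
    (hexp : ∀ z : ℂ, 2 < z.re → ∀ g, ψ z g = ∑ j, Q j z * b j g)
    (hQ : ∀ z : ℂ, 2 < z.re → ∀ j, Q j z = a j z * cS z)
    (hq : ∀ z : ℂ, 2 < z.re → ψ z g₁ = A z * cS z) :
    ∀ z : ℂ, 2 < z.re → ∀ g, ψ z g = amplitudeOfTranslate A a b g₁ g z * cS z := by
  intro z hz g
  have key : ψ z g = ψ z g₁ + ∑ j, Q j z * (b j g - b j g₁) := by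
    rw [hexp z hz g, hexp z hz g₁, ← sub_eq_iff_eq_add', ← Finset.sum_sub_distrib]
    exact Finset.sum_congr rfl fun j _ => by ring
  rw [key, amplitudeOfTranslate_apply, add_mul, Finset.sum_mul, hq z hz]
  congr 1
  exact Finset.sum_congr rfl fun j _ => by rw [hQ z hz j]; ring

/-- The same with the factorisation written `Q_j z = cS z · a_j z`. [cite: MoeglinWaldspurger1995, IV.1.11] -/
theorem hψ2_of_coordFactorisation' (ψ : ℂ → G → ℂ) (Q a : ι → ℂ → ℂ) (b : ι → G → ℂ) (A cS : ℂ → ℂ) (g₁ : G)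
    (hexp : ∀ z : ℂ, 2 < z.re → ∀ g, ψ z g = ∑ j, Q j z * b j g)
    (hQ : ∀ z : ℂ, 2 < z.re → ∀ j, Q j z = cS z * a j z)
    (hq : ∀ z : ℂ, 2 < z.re → ψ z g₁ = A z * cS z) :
    ∀ z : ℂ, 2 < z.re → ∀ g, ψ z g = amplitudeOfTranslate A a b g₁ g z * cS z :=
  hψ2_of_coordFactorisation ψ Q a b A cS g₁ hexp (fun z hz j => by rw [hQ z hz j, mul_comm]) hq

/-- Conversely the base-point row is the case `g = g₁` of `hψ2` (consistency read-back). [cite: MoeglinWaldspurger1995, IV.1.11] -/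
theorem base_of_hψ2 (ψ : ℂ → G → ℂ) (A : ℂ → ℂ) (a : ι → ℂ → ℂ) (b : ι → G → ℂ) (cS : ℂ → ℂ) (g₁ : G)
    (hψ2 : ∀ z : ℂ, 2 < z.re → ∀ g, ψ z g = amplitudeOfTranslate A a b g₁ g z * cS z) :
    ∀ z : ℂ, 2 < z.re → ψ z g₁ = A z * cS z := fun z hz => by
  rw [hψ2 z hz g₁, amplitudeOfTranslate_base]

/-! ## §3 The four amplitude rows in one conclusion -/

/-- **THE AMPLITUDE ROWS OF ★ `ctLedger_of_amplitudeRows_codiscrete`, ALL FOUR, ON THE COORDINATE ROAD.**  Given: `A` differentiable on `s` (in the application `s = {1 < Re}`, ★ p864534), the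
coordinate amplitudes `a_j` differentiable on `s`, the basis bound `‖b_j x‖ ≤ Mb`, and on `{2 < Re}` the expansion `ψ z g = Σ_j Q_j z·b_j g`, the factorisation `Q_j = a_j·cS` and the base point
`ψ z g₁ = A z·cS z`.  THEN for `Ag := amplitudeOfTranslate A a b g₁`: (`hAg`) every `Ag g` is differentiable on `s`; (`hAg1`) `Ag g₁ = A`; (`hM`) `‖Ag g (3∕2)‖ ≤ ‖A(3∕2)‖ + Σ_j ‖a_j(3∕2)‖·(Mb+Mb)`
for all `g`; (`hψ2`) `ψ z g = Ag g z·cS z` for all `z` with `2 < Re z` and all `g`. [cite: MoeglinWaldspurger1995, IV.1.9–IV.1.11] [cite: Langlands1976, §6, Appendix] [cite: Rogawski1990, §13.9 p. 229] -/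
theorem amplitudeRows_of_coordFactorisation {A : ℂ → ℂ} {s : Set ℂ} (hA : DifferentiableOn ℂ A s) {a : ι → ℂ → ℂ} (ha : ∀ j, DifferentiableOn ℂ (a j) s)
    {b : ι → G → ℂ} {Mb : ℝ} (hbM : ∀ j x, ‖b j x‖ ≤ Mb) (g₁ : G)
    (ψ : ℂ → G → ℂ) (Q : ι → ℂ → ℂ) (cS : ℂ → ℂ)
    (hexp : ∀ z : ℂ, 2 < z.re → ∀ g, ψ z g = ∑ j, Q j z * b j g)
    (hQ : ∀ z : ℂ, 2 < z.re → ∀ j, Q j z = a j z * cS z)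
    (hq : ∀ z : ℂ, 2 < z.re → ψ z g₁ = A z * cS z) :
    (∀ g, DifferentiableOn ℂ (amplitudeOfTranslate A a b g₁ g) s) ∧ amplitudeOfTranslate A a b g₁ g₁ = A ∧
      (∀ g, ‖amplitudeOfTranslate A a b g₁ g (3 / 2)‖ ≤ ‖A (3 / 2)‖ + ∑ j, ‖a j (3 / 2)‖ * (Mb + Mb)) ∧
      ∀ z : ℂ, 2 < z.re → ∀ g, ψ z g = amplitudeOfTranslate A a b g₁ g z * cS z :=
  ⟨differentiableOn_amplitudeOfTranslate hA ha b g₁, amplitudeOfTranslate_base A a b g₁, norm_amplitudeOfTranslate_three_halves_le A a hbM g₁,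
    hψ2_of_coordFactorisation ψ Q a b A cS g₁ hexp hQ hq⟩

/-- The same packaged with an existential bound `M` (the shape `{M : ℝ} (hM : ∀ g, ‖Ag g (3 ∕ 2)‖ ≤ M)` of the consumer). [cite: MoeglinWaldspurger1995, IV.1.11] -/
theorem amplitudeRows_of_coordFactorisation_exists {A : ℂ → ℂ} {s : Set ℂ} (hA : DifferentiableOn ℂ A s) {a : ι → ℂ → ℂ} (ha : ∀ j, DifferentiableOn ℂ (a j) s)
    {b : ι → G → ℂ} {Mb : ℝ} (hbM : ∀ j x, ‖b j x‖ ≤ Mb) (g₁ : G)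
    (ψ : ℂ → G → ℂ) (Q : ι → ℂ → ℂ) (cS : ℂ → ℂ)
    (hexp : ∀ z : ℂ, 2 < z.re → ∀ g, ψ z g = ∑ j, Q j z * b j g)
    (hQ : ∀ z : ℂ, 2 < z.re → ∀ j, Q j z = a j z * cS z)
    (hq : ∀ z : ℂ, 2 < z.re → ψ z g₁ = A z * cS z) :
    ∃ M : ℝ, (∀ g, DifferentiableOn ℂ (amplitudeOfTranslate A a b g₁ g) s) ∧ amplitudeOfTranslate A a b g₁ g₁ = A ∧
      (∀ g, ‖amplitudeOfTranslate A a b g₁ g (3 / 2)‖ ≤ M) ∧ ∀ z : ℂ, 2 < z.re → ∀ g, ψ z g = amplitudeOfTranslate A a b g₁ g z * cS z :=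
  ⟨_, amplitudeRows_of_coordFactorisation hA ha hbM g₁ ψ Q cS hexp hQ hq⟩

end Summit.HodgeConjecture.HodgeConjecture.Cruxes.H413.K2E1ChiAmplitudeOfTranslateU3

end
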